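import Summits.QuantumFields.BalabanUV.T4Continuum.Spine.NE1p.DressedSmallFieldRecordLabelsTorus
import Summits.QuantumFields.BalabanUV.T4Continuum.Support.SubstrateSlotActZero

/-!
# T⁴ programme, spine estimate NE1′ (node O3b/H2) — N0y's ENDs AT THE SUBSTRATE's SLOT ON THE NESTED TORI `(N, L·N)`: the second-step
# small-field ENDs (table pencil, road P1's source pencil) for the slot activity `Z ↦ Σ_{ℓ ∈ T Z} actOfLetters ℓA (emb Z) (φ Z ℓ)` over a WHOLE
# fine-torus label set `T Z`, the count DISCHARGED by S53, the non-admissible labels KILLED by the substrate's χ-letter lemma (B) — owner node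
# N1a PART 1 (PART 2 `DressedSmallFieldRecordLabelsCarriers` instantiates at the carriers of record with (A)'s dictionary)

Cell `pub-balaban`, sub-cell `t4`, BINDER-OWNERS row NE1′; owner lineage t4-ne1p-p1 (PROVER seat P1, «RG-trajectory comparison …
μ-uniformity through the printed small-field bounds»), generation 31; owner node N1a «N0y's ENDs AT THE CARRIERS OF RECORD» (the gen-30
handoff's ON-EVENT item; EVENT = substrate-p1 g6's ANSWER Q-NE1p-emb `CLAIMS.log` 2026-08-20 l.21854 and the ACCEPT of its modules; RE-SCOPED
by typer gen 8 l.22222 — the nested-tori faces of N0y are crew row S53), (D1) PART 1 of 2.  ADDITIVE — imports crew row S53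
`Spine/NE1p/DressedSmallFieldRecordLabelsTorus` (leaf-05-g12, p238702 ✓: `count_recordLabels_refined`; through it the owner's N0y∕N0r∕N0s) and
substrate W-23b = (B) `Support/SubstrateSlotActZero` (substrate-p1 g6, p238707 ✓: `actOfLetters_eq_zero_of_mem_cons`) ONLY; THEOREMS ONLY
(0 def, 0 `def … : Prop`, 0 cite); nothing of them restated — used BY NAME, once each per theorem.

WHAT (generic carriers `C`, slot letters `ℓA : ∀ X j, CoreLetters …`, coarse torus `TDom 4 N`, fine torus `TDom 4 (L·N)`).
* §1 **`attachedPart_locE_le_of_actOfLetters_recordLabels_refined`** ∕ **`muPart_locE_le_of_actOfLetters_recordLabels_refined`** — N0r's slot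
  ENDs `attachedPart_∕muPart_locE_le_of_actOfLetters` ONCE BY NAME at `D := tsys 4 N`, `G := tgeometry 4 N`, term index `C.Dom × J`,
  `terms Z := (terms₀ Z).map (ℓ ↦ (emb Z, φ Z ℓ))` for the owner's ADMISSIBLE fine-torus labels `terms₀ Z ⊆ T Z` (NE5-type labels
  `InnerLabel (TDom 4 (L·N)) Bnd`; an injective label transport `φ Z` into the slot's index `J`), the (2.38)-letter budget `hM3` SPLIT into
  the displayed per-label amplitude `hAmp` and S53's table-blind count `count_recordLabels_refined` (`Finset.sum_map` + N0s §1
  `sum_le_amp_mul_count`), and the activity REWRITTEN from the terms to the WHOLE label set `T Z` under the DISPLAYED zero-terms binder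
  `hkill` (every label of `T Z` outside `terms₀ Z` carries a small-field χ-constraint `(b, thr, true)` with `thr ≤ 0` — (B)'s
  `actOfLetters_eq_zero_of_mem_cons`, `Finset.sum_subset`).  ROAD P1: in the μ-END the source window `μ₁`∕`μ₀`∕`sμ` and the direction `v`
  occur ONLY in `hH`, `hAmp` and the conclusion — `hact` is GONE.
WHAT STAYS DISPLAYED (by name; NOTHING instantiated on Bałaban's densities): `hroom`; the slot letters' operator conditions `hm`∕`hN`∕`hq`
(rows NE2∕NE3's objects; NE5's factor-letter blocks); class radii `hO`∕`hH`; (B1b): `terms₀ ⊆ T` with `hadm` (N0y's dictionary form on the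
torus), `emb`∕`hscale`, `φ`; **`hkill`** (the zero-terms convention as a χ-letter — substrate ANSWER (c); WHICH labels = NE5's identification);
**`hAmp`** ((B3-form) READING); `bondsOf`∕`hb₀`; the located clauses and N0m's `hϱ`∕`hϱA` ((B5)-KIND arithmetic).  PART 2 discharges
`emb`∕`hscale`∕`terms₀`∕`T`∕`φ`∕`hadm` at the carriers of record.

PRINTED LOCI (TYPE∕CONTEXT only — [Balaban1988RGII] = CMP 116 (1988)): p. 12 «𝐃 ⊂ 𝐃_k», «the smallest localization domain Z₀ ∈ 𝐃_k
containing Y₀ and P … bonds of P … in the interior of Z₀»; p. 14 (2.9) «H(Z) = Σ_{Z₀} H(Z, Z₀)»; p. 15 (2.14) (label `(Z₀, 𝐃, P)`, «Y ⊂ Z₀,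
and Z̃₀ ⊂ Z ⊂ X»); p. 18 «|P| ≥ ½M⁻⁴|Z₀∖Y₀|».  pv22's ∕ the substrate's READING: `tsys`∕`torusTreeLen`∕`trefineDom`∕`domEmb`∕`fineEmb` model
Bałaban's 𝐃_k ⊂ 𝐃_{k+1} ∕ d_k ∕ refinement — asserted nowhere.  Nothing here is used as a fact about Bałaban's densities.

HONEST FRAMING.  By-name applications over binder SHAPES on CONSTRUCTED tori ∕ carriers; cores ∕ labels ∕ slot letters are the cell's typed
FORMAT of (2.14) and NE5's label TYPE, NOT Bałaban's functions; 0 binders instantiated on Bałaban's (2.14) densities; no wall item moves;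
wall v1.8 (T4-DAG v48 — words, not kind) does NOT move; R-t4r2-Q2 NOT met thereby; NE1′ ⇐ the named binders — NOT printed, NOT proved;
spine PROVED 0∕9; count 9 unchanged.  ABSOLUTE RULE honoured ([folklore] kernel theorems only; printed loci TYPE∕CONTEXT).  Rung (B)+1 on
ONE finite four-torus — NOT infinite volume, NOT a mass gap, NOT OS on ℝ⁴, NOT Clay.  HONEST DEPENDENCY: continuum YM on T⁴ ⇐ BetaPertH ∧
nine spine estimates (0/9 proved); BetaPertH ⇐ (D1) ∧ (D4) ∧ CAP+tail; G-an2-4 gates asym, D1 and NE2/3/4. -/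

noncomputable section

namespace Summit.QuantumFields.BalabanUV.T4Continuum.NE1p.DressedSmallFieldRecordLabelsSlot

open Metric Set Complex MeasureTheory
open scoped BigOperators
open Literature.MathematicalPhysics.QuantumFieldTheory.Balaban1983to89.T4OutputRate (Carriers)
open Literature.MathematicalPhysics.QuantumFieldTheory.Balaban1983to89.B13Resummation (locE locE_congr)
open Literature.MathematicalPhysics.QuantumFieldTheory.Balaban1983to89.TreeLengthTorus (TPt TDom tsys torusTreeLen)
open Literature.MathematicalPhysics.QuantumFieldTheory.Balaban1983to89.TreeLengthTorusGeometry (TTouch tgeometry)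
open Literature.MathematicalPhysics.QuantumFieldTheory.Balaban1983to89.B12TreeDecay (K₀)
open Summit.QuantumFields.BalabanUV.T4Continuum.B13HistMeasurable (MeasPotFrame B13HistM)
open Summit.QuantumFields.BalabanUV.T4Continuum.B13StepTermLabels (InnerLabel)
open Summit.QuantumFields.BalabanUV.T4Continuum.SubstrateActivities (CoreLetters coreOf actOfLetters)
open Summit.QuantumFields.BalabanUV.T4Continuum.SubstrateSlotActZero (actOfLetters_eq_zero_of_mem_cons)
open Summit.QuantumFields.BalabanUV.T4Continuum.TorusBlockRefinement (trefineDom)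
open Summit.QuantumFields.BalabanUV.T4Continuum.NE1p.DressedSmallFieldGeometry (torus_consts)
open Summit.QuantumFields.BalabanUV.T4Continuum.NE1p.DressedSmallFieldGeometryFaces (K₀_four)
open Summit.QuantumFields.BalabanUV.T4Continuum.NE1p.DressedSmallFieldFamilyCount (sum_le_amp_mul_count)
open Summit.QuantumFields.BalabanUV.T4Continuum.NE1p.DressedSmallFieldOnCoresSlot (attachedPart_locE_le_of_actOfLetters
  muPart_locE_le_of_actOfLetters)
open Summit.QuantumFields.BalabanUV.T4Continuum.NE1p.DressedSmallFieldRecordLabelsTorus (count_recordLabels_refined)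

/-! ## §1 THE SLOT ENDs ON THE NESTED TORI WITH THE ACTIVITY OVER THE WHOLE LABEL SET `T Z` (count by S53; pruning by the kill letter) -/

section Slot

variable {N : ℕ} [NeZero N] {L : ℕ} [NeZero L] {Bnd : Type} [DecidableEq Bnd]
variable {C : Carriers} (P : MeasPotFrame C) (Op : Type*) [NormedAddCommGroup Op] [NormedSpace ℂ Op] {J : Type*}
  (𝒴 : C.Dom → J → Type) [∀ X j, Fintype (𝒴 X j)] (dom : ∀ X j, 𝒴 X j → C.Dom)
  (Jc : C.Dom → J → Type) [∀ X j, Fintype (Jc X j)]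
  (V : C.Dom → J → Type) [∀ X j, NormedAddCommGroup (V X j)] [∀ X j, InnerProductSpace ℝ (V X j)]
  [∀ X j, MeasurableSpace (V X j)] [∀ X j, BorelSpace (V X j)] [∀ X j, FiniteDimensional ℝ (V X j)]

open Classical in
/-- **THE ATTACHED PART OF THE SLOT ACTIVITY OVER A WHOLE FINE-TORUS LABEL SET, THE SECOND-STEP COUNT DISCHARGED, NON-ADMISSIBLE LABELS
KILLED** (kernel; N0r's `attachedPart_locE_le_of_actOfLetters` ONCE BY NAME at `D := tsys 4 N`, `G := tgeometry 4 N`, term index `C.Dom × J`,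
`terms Z := (terms₀ Z).map (ℓ ↦ (emb Z, φ Z ℓ))`, `hM3 ⇐ hAmp ∧ count_recordLabels_refined` (S53 BY NAME, `Finset.sum_map`, N0s §1
`sum_le_amp_mul_count`), located letters by `torus_consts`∕`K₀_four`, `b₅ := 5r₁`; then the terms' activity REWRITTEN to the activity over
ALL of `T Z ⊇ terms₀ Z` by `Finset.sum_subset` + (B)'s `actOfLetters_eq_zero_of_mem_cons` under `hkill`).  Displayed: `hroom`, the slot
letters' operator conditions `hm`∕`hN`∕`hq`, the class radii `hO`∕`hH`; (B1b): the admissible labels `terms₀ Z ⊆ T Z` with `hadm` (N0y's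
dictionary form on the torus) and the label transport `φ` (injective); the ZERO-TERMS binder `hkill`; (B3-form) `hAmp`; `bondsOf`∕`hb₀`;
the located clauses; N0m's `hϱ`∕`hϱA`.  Conclusion: `‖E[Z ↦ Σ_{ℓ∈T Z} act (emb Z) (φ Z ℓ) o (h₀ + w)](X₀) − E[… o h₀](X₀)‖ ≤
4·(e·9·64·K₀(64,8)²)·A₁·e^{−r₁·torusTreeLen X₀}` — STATED THROUGH `tgeometry 4 N`'s FIELDS `ι`∕`cubes` and `(tsys 4 N).dj` (the
currency every abstract-geometry END carries; `tgeometry_cubes`∕`tsys_dj` are `rfl`), so that `locE`'s decidability instances agree with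
the owner's ENDs by construction in files that also import the carriers. [folklore] -/
theorem attachedPart_locE_le_of_actOfLetters_recordLabels_refined {Win : Set (ℕ → ℝ)}
    {ctr : ℕ → (ℕ → ℝ) → C.BgB → Op × B13HistM P} {ROp RHist R' : ℕ → ℝ} (ℓA : ∀ X j, CoreLetters P Op 𝒴 dom Jc V X j)
    {mq bq N₀ : ℕ → C.Dom × J → C.Dom → ℝ}
    (hroom : ∀ k, ROp k < R' k)
    (hm : ∀ k, ∀ g ∈ Win, ∀ (U : C.BgB) (X : C.Dom), C.scale X = k → ∀ p, 0 < mq k p X)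
    (hN : ∀ k, ∀ g ∈ Win, ∀ (U : C.BgB) (X : C.Dom), C.scale X = k → ∀ p : C.Dom × J,
      (∀ o ∈ ball (ctr k g U).1 (R' k),
        AEStronglyMeasurable ((ℓA p.1 p.2).N o) (coreOf P Op 𝒴 dom Jc V ℓA p.1 p.2).lam) ∧
      (∀ a, DifferentiableOn ℂ (fun o => (ℓA p.1 p.2).N o a) (ball (ctr k g U).1 (R' k))) ∧
      (∀ o ∈ ball (ctr k g U).1 (R' k), ∀ a, ‖(ℓA p.1 p.2).N o a‖ ≤ N₀ k p X))
    (hq : ∀ k, ∀ g ∈ Win, ∀ (U : C.BgB) (X : C.Dom), C.scale X = k → ∀ p : C.Dom × J,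
      (∀ o ∈ ball (ctr k g U).1 (R' k),
        AEStronglyMeasurable (Function.uncurry ((ℓA p.1 p.2).q o))
          ((coreOf P Op 𝒴 dom Jc V ℓA p.1 p.2).lam.prod volume)) ∧
      (∀ a v, DifferentiableOn ℂ (fun o => (ℓA p.1 p.2).q o a v) (ball (ctr k g U).1 (R' k))) ∧
      (∀ o ∈ ball (ctr k g U).1 (R' k), ∀ a v, mq k p X * ‖v‖ ^ 2 - bq k p X ≤ ((ℓA p.1 p.2).q o a v).re))
    {k : ℕ} {g : ℕ → ℝ} (hg : g ∈ Win) {U : C.BgB} {o : Op} {h₀ w : B13HistM P} {ϱ : ℝ}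
    (hO : ‖o - (ctr k g U).1‖ ≤ ROp k) (hH : ‖h₀ - (ctr k g U).2‖ + ϱ * ‖w‖ ≤ RHist k)
    {emb : (tsys 4 N).Dom → C.Dom} (hscale : ∀ Z, C.scale (emb Z) = k)
    (T terms₀ : (tsys 4 N).Dom → Finset (InnerLabel (TDom 4 (L * N)) Bnd)) (hsub : ∀ Z, terms₀ Z ⊆ T Z)
    (φ : (tsys 4 N).Dom → InnerLabel (TDom 4 (L * N)) Bnd → J) (hφ : ∀ Z, Function.Injective (φ Z))
    (hkill : ∀ Z, ∀ ℓ ∈ T Z, ℓ ∉ terms₀ Z →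
      ∃ (b : V (emb Z) (φ Z ℓ) →L[ℝ] ℝ) (thr : ℝ), thr ≤ 0 ∧ (b, thr, true) ∈ (ℓA (emb Z) (φ Z ℓ)).cons)
    {A₀ A₁ Rkp r₁ : ℝ} (X₀ : (tsys 4 N).Dom) (hA₀ : 0 ≤ A₀) (hA₁ : 0 ≤ A₁) (hr₁ : 0 ≤ r₁)
    (hrate : r₁ + 2 * (64 * Real.log 162) + 2 ≤ Rkp)
    (hsmall : (A₀ + ϱ * A₁) * Real.exp (5 * r₁ + 1) * K₀ 64 8 * 9 * 64 ≤ 1)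
    (bondsOf : Finset (TPt 4 (L * N)) → Finset Bnd) {δ κ α₆ R b₀ s t : ℝ} (hα₆ : 0 ≤ α₆)
    (hκ : 64 * Real.log 162 + 1 ≤ δ * κ) (h229 : Real.exp 1 * K₀ 64 8 * 64 * α₆ ≤ 1)
    (hs0 : 0 ≤ s) (hs1 : s ≤ 1) (ht : 0 ≤ t) (hb₀ : ∀ W, ((bondsOf W).card : ℝ) ≤ b₀ * W.card)
    (hRR : Rkp ≤ R - 64 * (Real.exp (R * 5) * s * Real.exp (b₀ * t)))
    (hadm : ∀ Z : (tsys 4 N).Dom, ∀ ℓ ∈ terms₀ Z, ℓ.Z₀ = trefineDom L N Z ∧ (∀ Y ∈ ℓ.fam, Y.1 ⊆ ℓ.Z₀.1) ∧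
      ℓ.P ⊆ bondsOf (ℓ.Z₀.1 \ ℓ.fam.biUnion fun Y : (tsys 4 (L * N)).Dom => Y.1) ∧
        (ℓ.Z₀.1 \ ℓ.fam.biUnion fun Y : (tsys 4 (L * N)).Dom => Y.1).card ≤ 2 * ℓ.P.card)
    (hAmp : ∀ Z : (tsys 4 N).Dom, Z.1 ⊆ X₀.1 → ∀ ℓ ∈ terms₀ Z,
      (coreOf P Op 𝒴 dom Jc V ℓA (emb Z) (φ Z ℓ)).lam.real univ *
          ((coreOf P Op 𝒴 dom Jc V ℓA (emb Z) (φ Z ℓ)).wB * N₀ k (emb Z, φ Z ℓ) (emb Z) *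
            Real.exp (bq k (emb Z, φ Z ℓ) (emb Z))) *
          (Real.pi / (mq k (emb Z, φ Z ℓ) (emb Z) / 2)) ^ (Module.finrank ℝ (V (emb Z) (φ Z ℓ)) / 2 : ℝ) *
        Real.exp ((coreOf P Op 𝒴 dom Jc V ℓA (emb Z) (φ Z ℓ)).N₁ * (‖h₀‖ + ϱ * ‖w‖)) ≤
      (A₀ + ϱ * A₁) * ((∏ Y ∈ ℓ.fam, (α₆ * Real.exp (-(δ * κ * torusTreeLen Y.1)) *
        Real.exp (-(R * (torusTreeLen Y.1 + 5))))) * (s ^ 2 * t) ^ ℓ.P.card))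
    (hϱ : 2 ≤ ϱ) (hϱA : A₀ ≤ ϱ * A₁) :
    ‖locE (tgeometry 4 N).ι (tgeometry 4 N).cubes
          (fun Z => ∑ ℓ ∈ T Z, actOfLetters P Op 𝒴 dom Jc V ℓA (emb Z) (φ Z ℓ) o (h₀ + w)) ((tgeometry 4 N).cubes X₀) -
        locE (tgeometry 4 N).ι (tgeometry 4 N).cubes
          (fun Z => ∑ ℓ ∈ T Z, actOfLetters P Op 𝒴 dom Jc V ℓA (emb Z) (φ Z ℓ) o h₀) ((tgeometry 4 N).cubes X₀)‖ ≤
      4 * (Real.exp 1 * 9 * 64 * K₀ 64 8 ^ 2) * A₁ * Real.exp (-(r₁ * (tsys 4 N).dj X₀)) := by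
  obtain ⟨hν, hκ₀, hc⟩ := torus_consts N
  have hK₀ := K₀_four (N := N)
  have hRkp : 0 ≤ Rkp := by
    have := Real.log_nonneg (show (1 : ℝ) ≤ 162 by norm_num)
    nlinarith
  -- the terms' activity IS the activity over all of `T Z` (killed labels contribute zero)
  have hsum : ∀ (Z : (tsys 4 N).Dom) (y : B13HistM P),
      ∑ p ∈ (terms₀ Z).map ⟨fun ℓ => (emb Z, φ Z ℓ), fun a b hab => hφ Z (Prod.ext_iff.1 hab).2⟩,
          actOfLetters P Op 𝒴 dom Jc V ℓA p.1 p.2 o y =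
        ∑ ℓ ∈ T Z, actOfLetters P Op 𝒴 dom Jc V ℓA (emb Z) (φ Z ℓ) o y := by
    intro Z y
    rw [Finset.sum_map]
    exact Finset.sum_subset (hsub Z) fun ℓ hℓ hnot => by
      obtain ⟨b, thr, hthr, hcns⟩ := hkill Z ℓ hℓ hnot
      exact actOfLetters_eq_zero_of_mem_cons P Op 𝒴 dom Jc V ℓA hcns hthr o y
  have h := attachedPart_locE_le_of_actOfLetters P Op 𝒴 dom Jc V (tsys 4 N) (tgeometry 4 N) ℓA hroom hm hN hq hg hO hH hscale
    (fun Z => (terms₀ Z).map ⟨fun ℓ => (emb Z, φ Z ℓ), fun a b hab => hφ Z (Prod.ext_iff.1 hab).2⟩)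
    (R := Rkp) (b₅ := 5 * r₁) (X₀ := X₀) hA₀ hA₁ hr₁ (le_of_eq (by ring)) (by rw [hκ₀]; exact hrate) (by rw [hK₀, hν, hc]; exact hsmall)
    (fun Z hZ => by
      rw [Finset.sum_map]
      exact sum_le_amp_mul_count (add_nonneg hA₀ (mul_nonneg (by linarith) hA₁)) (hAmp Z hZ)
        (count_recordLabels_refined bondsOf hα₆ hκ h229 hs0 hs1 ht hb₀ hRkp hRR hadm Z))
    hϱ hϱA
  rw [hν, hc, hK₀] at h
  -- match the activities by `locE_congr` (the killed labels contribute zero), in `tgeometry`'s own currency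
  rw [locE_congr (ι := (tgeometry 4 N).ι) (cubes := (tgeometry 4 N).cubes) (X := (tgeometry 4 N).cubes X₀)
      (w := fun Z => ∑ ℓ ∈ T Z, actOfLetters P Op 𝒴 dom Jc V ℓA (emb Z) (φ Z ℓ) o (h₀ + w))
      (w' := fun Z => ∑ p ∈ (terms₀ Z).map ⟨fun ℓ => (emb Z, φ Z ℓ), fun a b hab => hφ Z (Prod.ext_iff.1 hab).2⟩,
        actOfLetters P Op 𝒴 dom Jc V ℓA p.1 p.2 o (h₀ + w)) (fun Z _ => (hsum Z _).symm),
    locE_congr (ι := (tgeometry 4 N).ι) (cubes := (tgeometry 4 N).cubes) (X := (tgeometry 4 N).cubes X₀)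
      (w := fun Z => ∑ ℓ ∈ T Z, actOfLetters P Op 𝒴 dom Jc V ℓA (emb Z) (φ Z ℓ) o h₀)
      (w' := fun Z => ∑ p ∈ (terms₀ Z).map ⟨fun ℓ => (emb Z, φ Z ℓ), fun a b hab => hφ Z (Prod.ext_iff.1 hab).2⟩,
        actOfLetters P Op 𝒴 dom Jc V ℓA p.1 p.2 o h₀) (fun Z _ => (hsum Z _).symm)]
  exact h

open Classical in
/-- **THE μ-PART (ROAD P1's SOURCE PENCIL `h₀ + s • v`, `‖s‖ < μ₁`) OF THE SLOT ACTIVITY OVER A WHOLE FINE-TORUS LABEL SET, THE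
SECOND-STEP COUNT DISCHARGED, NON-ADMISSIBLE LABELS KILLED** (kernel; N0r's `muPart_locE_le_of_actOfLetters` ONCE BY NAME with the same
plug-ins as the attached END above).  The source window `μ₁`∕`μ₀`∕`sμ` and the direction `v` occur ONLY in `hH`, `hAmp` and the conclusion:
`‖E[Z ↦ Σ_{ℓ∈T Z} act (emb Z) (φ Z ℓ) o (h₀ + sμ•v)](X₀) − E[… o h₀](X₀)‖ ≤ e·9·64·K₀(64,8)²·A·e^{−r₁·torusTreeLen X₀}·μ₀∕(μ₁ − μ₀)`. [folklore] -/
theorem muPart_locE_le_of_actOfLetters_recordLabels_refined {Win : Set (ℕ → ℝ)}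
    {ctr : ℕ → (ℕ → ℝ) → C.BgB → Op × B13HistM P} {ROp RHist R' : ℕ → ℝ} (ℓA : ∀ X j, CoreLetters P Op 𝒴 dom Jc V X j)
    {mq bq N₀ : ℕ → C.Dom × J → C.Dom → ℝ}
    (hroom : ∀ k, ROp k < R' k)
    (hm : ∀ k, ∀ g ∈ Win, ∀ (U : C.BgB) (X : C.Dom), C.scale X = k → ∀ p, 0 < mq k p X)
    (hN : ∀ k, ∀ g ∈ Win, ∀ (U : C.BgB) (X : C.Dom), C.scale X = k → ∀ p : C.Dom × J,
      (∀ o ∈ ball (ctr k g U).1 (R' k),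
        AEStronglyMeasurable ((ℓA p.1 p.2).N o) (coreOf P Op 𝒴 dom Jc V ℓA p.1 p.2).lam) ∧
      (∀ a, DifferentiableOn ℂ (fun o => (ℓA p.1 p.2).N o a) (ball (ctr k g U).1 (R' k))) ∧
      (∀ o ∈ ball (ctr k g U).1 (R' k), ∀ a, ‖(ℓA p.1 p.2).N o a‖ ≤ N₀ k p X))
    (hq : ∀ k, ∀ g ∈ Win, ∀ (U : C.BgB) (X : C.Dom), C.scale X = k → ∀ p : C.Dom × J,
      (∀ o ∈ ball (ctr k g U).1 (R' k),
        AEStronglyMeasurable (Function.uncurry ((ℓA p.1 p.2).q o))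
          ((coreOf P Op 𝒴 dom Jc V ℓA p.1 p.2).lam.prod volume)) ∧
      (∀ a v, DifferentiableOn ℂ (fun o => (ℓA p.1 p.2).q o a v) (ball (ctr k g U).1 (R' k))) ∧
      (∀ o ∈ ball (ctr k g U).1 (R' k), ∀ a v, mq k p X * ‖v‖ ^ 2 - bq k p X ≤ ((ℓA p.1 p.2).q o a v).re))
    {k : ℕ} {g : ℕ → ℝ} (hg : g ∈ Win) {U : C.BgB} {o : Op} {h₀ v : B13HistM P} {μ₁ : ℝ}
    (hO : ‖o - (ctr k g U).1‖ ≤ ROp k) (hH : ‖h₀ - (ctr k g U).2‖ + μ₁ * ‖v‖ ≤ RHist k)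
    {emb : (tsys 4 N).Dom → C.Dom} (hscale : ∀ Z, C.scale (emb Z) = k)
    (T terms₀ : (tsys 4 N).Dom → Finset (InnerLabel (TDom 4 (L * N)) Bnd)) (hsub : ∀ Z, terms₀ Z ⊆ T Z)
    (φ : (tsys 4 N).Dom → InnerLabel (TDom 4 (L * N)) Bnd → J) (hφ : ∀ Z, Function.Injective (φ Z))
    (hkill : ∀ Z, ∀ ℓ ∈ T Z, ℓ ∉ terms₀ Z →
      ∃ (b : V (emb Z) (φ Z ℓ) →L[ℝ] ℝ) (thr : ℝ), thr ≤ 0 ∧ (b, thr, true) ∈ (ℓA (emb Z) (φ Z ℓ)).cons)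
    {A Rkp r₁ μ₀ : ℝ} (X₀ : (tsys 4 N).Dom) {sμ : ℂ} (hA : 0 ≤ A) (hr₁ : 0 ≤ r₁)
    (hrate : r₁ + 2 * (64 * Real.log 162) + 2 ≤ Rkp)
    (hsmall : A * Real.exp (5 * r₁ + 1) * K₀ 64 8 * 9 * 64 ≤ 1)
    (bondsOf : Finset (TPt 4 (L * N)) → Finset Bnd) {δ κ α₆ R b₀ s t : ℝ} (hα₆ : 0 ≤ α₆)
    (hκ : 64 * Real.log 162 + 1 ≤ δ * κ) (h229 : Real.exp 1 * K₀ 64 8 * 64 * α₆ ≤ 1)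
    (hs0 : 0 ≤ s) (hs1 : s ≤ 1) (ht : 0 ≤ t) (hb₀ : ∀ W, ((bondsOf W).card : ℝ) ≤ b₀ * W.card)
    (hRR : Rkp ≤ R - 64 * (Real.exp (R * 5) * s * Real.exp (b₀ * t)))
    (hadm : ∀ Z : (tsys 4 N).Dom, ∀ ℓ ∈ terms₀ Z, ℓ.Z₀ = trefineDom L N Z ∧ (∀ Y ∈ ℓ.fam, Y.1 ⊆ ℓ.Z₀.1) ∧
      ℓ.P ⊆ bondsOf (ℓ.Z₀.1 \ ℓ.fam.biUnion fun Y : (tsys 4 (L * N)).Dom => Y.1) ∧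
        (ℓ.Z₀.1 \ ℓ.fam.biUnion fun Y : (tsys 4 (L * N)).Dom => Y.1).card ≤ 2 * ℓ.P.card)
    (hAmp : ∀ Z : (tsys 4 N).Dom, Z.1 ⊆ X₀.1 → ∀ ℓ ∈ terms₀ Z,
      (coreOf P Op 𝒴 dom Jc V ℓA (emb Z) (φ Z ℓ)).lam.real univ *
          ((coreOf P Op 𝒴 dom Jc V ℓA (emb Z) (φ Z ℓ)).wB * N₀ k (emb Z, φ Z ℓ) (emb Z) *
            Real.exp (bq k (emb Z, φ Z ℓ) (emb Z))) *
          (Real.pi / (mq k (emb Z, φ Z ℓ) (emb Z) / 2)) ^ (Module.finrank ℝ (V (emb Z) (φ Z ℓ)) / 2 : ℝ) *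
        Real.exp ((coreOf P Op 𝒴 dom Jc V ℓA (emb Z) (φ Z ℓ)).N₁ * (‖h₀‖ + μ₁ * ‖v‖)) ≤
      A * ((∏ Y ∈ ℓ.fam, (α₆ * Real.exp (-(δ * κ * torusTreeLen Y.1)) *
        Real.exp (-(R * (torusTreeLen Y.1 + 5))))) * (s ^ 2 * t) ^ ℓ.P.card))
    (h0 : 0 < μ₀) (h01 : μ₀ < μ₁) (hμ : ‖sμ‖ ≤ μ₀) :
    ‖locE (tgeometry 4 N).ι (tgeometry 4 N).cubes
          (fun Z => ∑ ℓ ∈ T Z, actOfLetters P Op 𝒴 dom Jc V ℓA (emb Z) (φ Z ℓ) o (h₀ + sμ • v)) ((tgeometry 4 N).cubes X₀) -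
        locE (tgeometry 4 N).ι (tgeometry 4 N).cubes
          (fun Z => ∑ ℓ ∈ T Z, actOfLetters P Op 𝒴 dom Jc V ℓA (emb Z) (φ Z ℓ) o h₀) ((tgeometry 4 N).cubes X₀)‖ ≤
      Real.exp 1 * 9 * 64 * K₀ 64 8 ^ 2 * A * Real.exp (-(r₁ * (tsys 4 N).dj X₀)) * (μ₀ / (μ₁ - μ₀)) := by
  obtain ⟨hν, hκ₀, hc⟩ := torus_consts N
  have hK₀ := K₀_four (N := N)
  have hRkp : 0 ≤ Rkp := by
    have := Real.log_nonneg (show (1 : ℝ) ≤ 162 by norm_num)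
    nlinarith
  have hsum : ∀ (Z : (tsys 4 N).Dom) (y : B13HistM P),
      ∑ p ∈ (terms₀ Z).map ⟨fun ℓ => (emb Z, φ Z ℓ), fun a b hab => hφ Z (Prod.ext_iff.1 hab).2⟩,
          actOfLetters P Op 𝒴 dom Jc V ℓA p.1 p.2 o y =
        ∑ ℓ ∈ T Z, actOfLetters P Op 𝒴 dom Jc V ℓA (emb Z) (φ Z ℓ) o y := by
    intro Z y
    rw [Finset.sum_map]
    exact Finset.sum_subset (hsub Z) fun ℓ hℓ hnot => by
      obtain ⟨b, thr, hthr, hcns⟩ := hkill Z ℓ hℓ hnot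
      exact actOfLetters_eq_zero_of_mem_cons P Op 𝒴 dom Jc V ℓA hcns hthr o y
  have h := muPart_locE_le_of_actOfLetters P Op 𝒴 dom Jc V (tsys 4 N) (tgeometry 4 N) ℓA hroom hm hN hq hg hO hH hscale
    (fun Z => (terms₀ Z).map ⟨fun ℓ => (emb Z, φ Z ℓ), fun a b hab => hφ Z (Prod.ext_iff.1 hab).2⟩)
    (R := Rkp) (b₅ := 5 * r₁) (X₀ := X₀) hA hr₁ (le_of_eq (by ring)) (by rw [hκ₀]; exact hrate) (by rw [hK₀, hν, hc]; exact hsmall)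
    (fun Z hZ => by
      rw [Finset.sum_map]
      exact sum_le_amp_mul_count hA (hAmp Z hZ)
        (count_recordLabels_refined bondsOf hα₆ hκ h229 hs0 hs1 ht hb₀ hRkp hRR hadm Z))
    h0 h01 hμ
  rw [hν, hc, hK₀] at h
  -- match the activities by `locE_congr` (the killed labels contribute zero), in `tgeometry`'s own currency
  rw [locE_congr (ι := (tgeometry 4 N).ι) (cubes := (tgeometry 4 N).cubes) (X := (tgeometry 4 N).cubes X₀)
      (w := fun Z => ∑ ℓ ∈ T Z, actOfLetters P Op 𝒴 dom Jc V ℓA (emb Z) (φ Z ℓ) o (h₀ + sμ • v))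
      (w' := fun Z => ∑ p ∈ (terms₀ Z).map ⟨fun ℓ => (emb Z, φ Z ℓ), fun a b hab => hφ Z (Prod.ext_iff.1 hab).2⟩,
        actOfLetters P Op 𝒴 dom Jc V ℓA p.1 p.2 o (h₀ + sμ • v)) (fun Z _ => (hsum Z _).symm),
    locE_congr (ι := (tgeometry 4 N).ι) (cubes := (tgeometry 4 N).cubes) (X := (tgeometry 4 N).cubes X₀)
      (w := fun Z => ∑ ℓ ∈ T Z, actOfLetters P Op 𝒴 dom Jc V ℓA (emb Z) (φ Z ℓ) o h₀)
      (w' := fun Z => ∑ p ∈ (terms₀ Z).map ⟨fun ℓ => (emb Z, φ Z ℓ), fun a b hab => hφ Z (Prod.ext_iff.1 hab).2⟩,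
        actOfLetters P Op 𝒴 dom Jc V ℓA p.1 p.2 o h₀) (fun Z _ => (hsum Z _).symm)]
  exact h

end Slot

end Summit.QuantumFields.BalabanUV.T4Continuum.NE1p.DressedSmallFieldRecordLabelsSlot

end
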